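/-
Copyright (c) 2026 the pub-hodgecm-mathlib formalisation cell (harness21).  Prover seat hodgecm-mathlib-K2E3-p17 (g11), HCML Track B «K2-LIT» ∕ h413
(`stmt-HodgeConjecture-24833`), R90-TF section S3, (U3-F) assembly layer A «the socket from a dense equivariant CM embedding» (captain's skeleton
`R90/S3/SKELETON-P8-AuxGlobaliseField.K2E3-p17-g11.md` 941dd0e5, dealer R90-C12-plan (g2) 00:59:22Z).  2026-09-05.
-/
import Summits.HodgeConjecture.HodgeConjecture.Theorems.R90S3PlantedLocalIso   -- ★ P8a (K2E4-p14): `exists_localRing_equiv_of_denseRange_equivariant`, `mem_under_iff_valued_apply_lt_one`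
import HarnessLib

/-!
# R90-TF · S3 · THEOREMS — `R90S3AuxGlobaliseFieldOfDenseCM` ((U3-F) assembly, layer A): the (U3-F) socket `stub_R90_S3_auxGlobaliseField` follows from a CM
# number field `L′` with a DENSE, conjugation-EQUIVARIANT embedding `J : L′ → L_w`, `3 ≤ [L′⁺ : ℚ]`, and `L′ ∕ L′⁺` unramified at every finite place of `L′⁺`
# other than the place of `J`

R90-TF section S3 (dealer R90-C12-plan (g2)); crux H413 (`stmt-HodgeConjecture-24833`, lane `--supports … --as helper`), route `HCCMUnconditional`.  The socket
(`Cruxes/H413/Lines/R90_S3_LocalTransportWaveG.lean` :669–:677): given the CM field `L`, a finite place `v` of `L⁺` NON-SPLIT in `L` (`hv`), produce a CM field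
`L′ : Type`, a finite place `v′` of `L′⁺` and a bi-continuous conjugation-intertwining `Φ : L ⊗_{L⁺} L⁺_v ≃+* L′ ⊗_{L′⁺} L′⁺_{v′}` with `L′ ∕ L′⁺` unramified at every
finite `w′ ≠ v′`, `3 ≤ [L′⁺ : ℚ]`, `v′` non-split.  THIS FILE is the last step of the captain's skeleton: it reduces the socket to the GLOBAL DATUM «a CM number field
`L′` with a ring homomorphism `J : L′ →+* L_w` (`w` the place over `v`) of dense image intertwining the complex conjugations, with `3 ≤ [L′⁺ : ℚ]`, and with
`L′ ∕ L′⁺` unramified at every finite place `w′` of `L′⁺` that is NOT the place cut out by `J`» — the local clauses and the non-split clause are ★ P8a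
(`R90S3PlantedLocalIso.exists_localRing_equiv_of_denseRange_equivariant`, K2E4-p14), and the excluded place is identified with P8a's `v′` by ★
`mem_under_iff_valued_apply_lt_one`.  The global datum itself is the planting (skeleton layer B: ★ P3a∕P3b∕P4∕P4′∕P5∕P6∕P7∕P9′∕P1∕P2″ + glue).  ★-only imports;
THEOREMS ONLY (no `def`, no `instance`, no notation, no named fact, no `sorry`); never imports `Cruxes/…/Lines`.
* `auxGlobaliseField_of_denseCM` — at a given conjugation-fixed `w ∣ v` and a given datum `(L′, J, hJ, hJσ, h3, hur)`: the socket's six clauses.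
* **`auxGlobaliseField_of_exists_denseCM`** — the socket conclusion VERBATIM from `hv` and the existence of the datum at every conjugation-fixed `w ∣ v`
  (PLUG SHAPE: `stub_R90_S3_auxGlobaliseField L H′ v hv := auxGlobaliseField_of_exists_denseCM L v hv (plantedDenseCM L v)` once layer B lands).
* **`auxGlobaliseField_of_exists_place_denseCM`** — the same from ONE conjugation-fixed `w ∣ v` packaged with the datum (the shape ★ P8b
  `exists_denseRange_equivariant_lift` produces; `hv` not needed).

HONEST LABEL: hypothesis-first — (U3-F) is a GENUINE residual until layer B is ★ and G plugs; HC_CM is proved only modulo the 7 printed citations (2 remaining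
named inputs: hLiu418 = stmt-HodgeConjecture-24832, h413 = stmt-HodgeConjecture-24833) until rung 0 closes; count-neutral.
References: [Rogawski1990] §13.8 pp. 212, 216 («we can choose `E∕F` and `w` such that `E_w∕F_w` is isomorphic to `E′∕F′` and `E∕F` is a CM field»);
[CasselsFrohlichANT1967] Ch. II §10, Ch. VII §1.1.
-/

set_option autoImplicit false
-- the mandated namespace repeats the single-problem summit's segment (`HodgeConjecture.HodgeConjecture`)
set_option linter.dupNamespace false

noncomputable section

open IsDedekindDomain NumberField Topology
open Literature.NumberTheory.Automorphic Literature.NumberTheory.Automorphic.UnitaryGroup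

namespace Summit.HodgeConjecture.HodgeConjecture.R90.S3

variable (L : Type) [Field L] [NumberField L] [IsCMField L] (v : HeightOneSpectrum (𝓞 ↥(maximalRealSubfield L)))

/-- **Layer A at a given place `w ∣ v`.**  From a conjugation-fixed `w ∣ v`, a CM number field `L′`, a ring homomorphism `J : L′ →+* L_w` with dense image
intertwining the complex conjugations, `3 ≤ [L′⁺ : ℚ]`, and «`L′ ∕ L′⁺` unramified at every finite place `w′` of `L′⁺` other than the one cut out by `J`»: the
six clauses of the (U3-F) socket at the place `v′` of ★ P8a. [cite: Rogawski1990, §13.8 p. 216] [cite: CasselsFrohlichANT1967, Ch. II §10] -/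
theorem auxGlobaliseField_of_denseCM (w : PlacesOver L v) (hw : IsCMField.complexConj L • w.1 = w.1)
    (L' : Type) [Field L'] [NumberField L'] [IsCMField L'] (J : L' →+* w.1.adicCompletion L) (hJ : DenseRange J)
    (hJσ : ∀ x : L', J (IsCMField.complexConj L' x) = galAdicCompletionMap (L := L) (IsCMField.complexConj L) hw (J x))
    (h3 : 3 ≤ Module.finrank ℚ ↥(maximalRealSubfield L'))
    (hur : ∀ w' : HeightOneSpectrum (𝓞 ↥(maximalRealSubfield L')),
      (¬ ∀ x : 𝓞 ↥(maximalRealSubfield L'), x ∈ w'.asIdeal ↔ Valued.v (J (algebraMap ↥(maximalRealSubfield L') L' x)) < 1) →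
      ∀ W : PlacesOver L' w', Algebra.IsUnramifiedAt (𝓞 ↥(maximalRealSubfield L')) W.1.asIdeal) :
    ∃ (v' : HeightOneSpectrum (𝓞 ↥(maximalRealSubfield L'))) (Φ : UnitaryGroup.LocalRing L v ≃+* UnitaryGroup.LocalRing L' v'),
      Continuous Φ ∧ Continuous Φ.symm ∧
      (∀ x, Φ ((conjLocal L (IsCMField.complexConj L) v) x) = (conjLocal L' (IsCMField.complexConj L') v') (Φ x)) ∧
      (∀ w' : HeightOneSpectrum (𝓞 ↥(maximalRealSubfield L')), w' ≠ v' →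
        ∀ W : UnitaryGroup.PlacesOver L' w', Algebra.IsUnramifiedAt (𝓞 ↥(maximalRealSubfield L')) W.1.asIdeal) ∧
      3 ≤ Module.finrank ℚ ↥(maximalRealSubfield L') ∧
      (∀ w' : UnitaryGroup.PlacesOver L' v', IsCMField.complexConj L' • w'.1 = w'.1) := by
  obtain ⟨v', w'P, ψ, Φ, hw'mem, -, -, -, hΦc, hΦc', hΦσ, hns, -⟩ :=
    exists_localRing_equiv_of_denseRange_equivariant L v w hw L' J hJσ hJ
  refine ⟨v', Φ, hΦc, hΦc', hΦσ, fun w' hw'ne => hur w' fun hchar => hw'ne ?_, h3, hns⟩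
  -- a place with the same membership predicate as `v′ = w′_J ∩ 𝓞_{L′⁺}` IS `v′`
  have hv'char : ∀ x : 𝓞 ↥(maximalRealSubfield L'),
      x ∈ v'.asIdeal ↔ Valued.v (J (algebraMap ↥(maximalRealSubfield L') L' x)) < 1 := by
    intro x
    rw [← mem_under_iff_valued_apply_lt_one L v w L' J hw'mem x, w'P.2]
  apply HeightOneSpectrum.ext
  ext x
  rw [hchar x, hv'char x]

/-- **Layer A, socket shape.**  If `v` is non-split in `L` (`hv`, the socket's hypothesis) and at every conjugation-fixed place `w ∣ v` there is a datum
«CM number field `L′`, dense conjugation-equivariant `J : L′ →+* L_w`, `3 ≤ [L′⁺:ℚ]`, unramified off the place of `J`», then the (U3-F) socket conclusion holds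
VERBATIM. [cite: Rogawski1990, §13.8 pp. 212, 216] [cite: CasselsFrohlichANT1967, Ch. VII §1.1] -/
theorem auxGlobaliseField_of_exists_denseCM (hv : ∀ w : UnitaryGroup.PlacesOver L v, IsCMField.complexConj L • w.1 = w.1)
    (hex : ∀ (w : PlacesOver L v) (hw : IsCMField.complexConj L • w.1 = w.1),
      ∃ (L' : Type) (_ : Field L') (_ : NumberField L') (_ : IsCMField L') (J : L' →+* w.1.adicCompletion L),
        DenseRange J ∧
        (∀ x : L', J (IsCMField.complexConj L' x) = galAdicCompletionMap (L := L) (IsCMField.complexConj L) hw (J x)) ∧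
        3 ≤ Module.finrank ℚ ↥(maximalRealSubfield L') ∧
        (∀ w' : HeightOneSpectrum (𝓞 ↥(maximalRealSubfield L')),
          (¬ ∀ x : 𝓞 ↥(maximalRealSubfield L'), x ∈ w'.asIdeal ↔ Valued.v (J (algebraMap ↥(maximalRealSubfield L') L' x)) < 1) →
          ∀ W : PlacesOver L' w', Algebra.IsUnramifiedAt (𝓞 ↥(maximalRealSubfield L')) W.1.asIdeal)) :
    ∃ (L' : Type) (_ : Field L') (_ : NumberField L') (_ : IsCMField L') (v' : HeightOneSpectrum (𝓞 ↥(maximalRealSubfield L')))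
      (Φ : UnitaryGroup.LocalRing L v ≃+* UnitaryGroup.LocalRing L' v'),
      Continuous Φ ∧ Continuous Φ.symm ∧
      (∀ x, Φ ((conjLocal L (IsCMField.complexConj L) v) x) = (conjLocal L' (IsCMField.complexConj L') v') (Φ x)) ∧
      (∀ w' : HeightOneSpectrum (𝓞 ↥(maximalRealSubfield L')), w' ≠ v' → ∀ W : UnitaryGroup.PlacesOver L' w', Algebra.IsUnramifiedAt (𝓞 ↥(maximalRealSubfield L')) W.1.asIdeal) ∧
      3 ≤ Module.finrank ℚ ↥(maximalRealSubfield L') ∧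
      (∀ w' : UnitaryGroup.PlacesOver L' v', IsCMField.complexConj L' • w'.1 = w'.1) := by
  obtain ⟨w⟩ : Nonempty (PlacesOver L v) := inferInstance
  obtain ⟨L', _, _, _, J, hJ, hJσ, h3, hur⟩ := hex w (hv w)
  obtain ⟨v', Φ, h⟩ := auxGlobaliseField_of_denseCM L v w (hv w) L' J hJ hJσ h3 hur
  exact ⟨L', inferInstance, inferInstance, inferInstance, v', Φ, h⟩

/-- **Layer A, socket shape from ONE place** (the form ★ P8b `R90S3QuadraticDenseLift.exists_denseRange_equivariant_lift` delivers: it PRODUCES the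
conjugation-fixed `w ∣ v` together with `J`).  If there are a conjugation-fixed `w ∣ v` and a datum «CM number field `L′`, dense conjugation-equivariant
`J : L′ →+* L_w`, `3 ≤ [L′⁺:ℚ]`, unramified off the place of `J`», then the (U3-F) socket conclusion holds VERBATIM (the socket's `hv` is not even needed here:
non-splitness is read off `hw` by ★ P8a). [cite: Rogawski1990, §13.8 pp. 212, 216] [cite: CasselsFrohlichANT1967, Ch. VII §1.1] -/
theorem auxGlobaliseField_of_exists_place_denseCM
    (hex : ∃ (w : PlacesOver L v) (hw : IsCMField.complexConj L • w.1 = w.1)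
      (L' : Type) (_ : Field L') (_ : NumberField L') (_ : IsCMField L') (J : L' →+* w.1.adicCompletion L),
        DenseRange J ∧
        (∀ x : L', J (IsCMField.complexConj L' x) = galAdicCompletionMap (L := L) (IsCMField.complexConj L) hw (J x)) ∧
        3 ≤ Module.finrank ℚ ↥(maximalRealSubfield L') ∧
        (∀ w' : HeightOneSpectrum (𝓞 ↥(maximalRealSubfield L')),
          (¬ ∀ x : 𝓞 ↥(maximalRealSubfield L'), x ∈ w'.asIdeal ↔ Valued.v (J (algebraMap ↥(maximalRealSubfield L') L' x)) < 1) →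
          ∀ W : PlacesOver L' w', Algebra.IsUnramifiedAt (𝓞 ↥(maximalRealSubfield L')) W.1.asIdeal)) :
    ∃ (L' : Type) (_ : Field L') (_ : NumberField L') (_ : IsCMField L') (v' : HeightOneSpectrum (𝓞 ↥(maximalRealSubfield L')))
      (Φ : UnitaryGroup.LocalRing L v ≃+* UnitaryGroup.LocalRing L' v'),
      Continuous Φ ∧ Continuous Φ.symm ∧
      (∀ x, Φ ((conjLocal L (IsCMField.complexConj L) v) x) = (conjLocal L' (IsCMField.complexConj L') v') (Φ x)) ∧
      (∀ w' : HeightOneSpectrum (𝓞 ↥(maximalRealSubfield L')), w' ≠ v' → ∀ W : UnitaryGroup.PlacesOver L' w', Algebra.IsUnramifiedAt (𝓞 ↥(maximalRealSubfield L')) W.1.asIdeal) ∧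
      3 ≤ Module.finrank ℚ ↥(maximalRealSubfield L') ∧
      (∀ w' : UnitaryGroup.PlacesOver L' v', IsCMField.complexConj L' • w'.1 = w'.1) := by
  obtain ⟨w, hw, L', _, _, _, J, hJ, hJσ, h3, hur⟩ := hex
  obtain ⟨v', Φ, h⟩ := auxGlobaliseField_of_denseCM L v w hw L' J hJ hJσ h3 hur
  exact ⟨L', inferInstance, inferInstance, inferInstance, v', Φ, h⟩

end Summit.HodgeConjecture.HodgeConjecture.R90.S3

end
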